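import Mathlib
import HarnessLib
import Summits.HubbardSuperconductivity.HubbardSuperconductivity.Theorems.KLProgrammeKLRegimeOverlapWtColFlowDeep

/-!
# K3 VL child `KLRegimeVolumeLimitV17F2` (stmt-HubbardSuperconductivity-20440), blueprint v5 M3b-j (iii) AT A COMMON FRAME ON TWO LATTICES: the WEIGHTED
# overlap / re-sectorisation constants of `E_V(klAnisoFamily J′)·S_V(F̃_k)` sampled on ANY lattice `V` at the COARSE volume's flow frame `K_n`, deep window

Cell `gate-hubbard-kl`, seat p3 (g12).  k3c4-p1's M5 step (`…TwoVolumeModelScaleSucc`) reads the transfer data `TransferWtData T⁺ ed ed₁ Λ_T cW` of the fine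
volume's block substitution `T⁺_{L″} = (ε•E_{L″}(F′)·S_{L″}(F̃₁)) ⊕ J` at the COMMON frame `K` (the coarse top frame).  The flow-frame doors
`overlapWt_jump_sums_klEng_flow_deep` (p3 g11) / `overlapWt_colSum_klEng_flow_deep` (p3 g11) tie the lattice of `E·S` to the frame's; this file DECOUPLES
them exactly as `…AlphaWtSectionalFlowDeepVol` does for the covariance data: the regime door `charSumWt_klAnisoPair_nb_of_thresholds` takes ANY admissible frame
and ANY lattice with `β² ≤ V`, `β ≤ M`, and the order-three datum of `K_n` is lattice-free.

* **`charSumWt_nbWindow_klEng_flow_deep_vol (d)`** — the weighted neighbouring character-sum bounds `≤ C_T·M·V²` on lattice `V`, frame `K_n` of volume `L`;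
* **`overlapWt_jump_sums_klEng_flow_deep_vol (d)`** — weighted ROW sums `≤ 81·C_J·M/β` and the two per-pair position sums `≤ 3·C_J·M/β` of
  `E_V(klAnisoFamily_V J′[K_n])·S_V(F̃_k[K_n])` (weight `klScaleWt V M β J′`), every `V` with `klEngL₃ β U ≤ V`;
* **`overlapWt_colSum_klEng_flow_deep_vol (d)`** — the full weighted COLUMN sums `≤ 81·2^{J′−k}·C_J·M/β` of the same matrix.
The `(1 + Λ_T·tnorm)` currency of `TransferWtData.row/col` follows by `…TwoVolumeDataKitWt.one_add_mul_tnorm_le_klScaleWt_pair` (`Λ_T ≤ Λ_{J′}`); the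
`ε`-scaling, the `⊕ J` block and the block covariance are the composition's (k3c4-p1).

Everything is proved; no definitions; nothing about the model is asserted. [cite: BenfattoGiulianiMastropietro2006, §2.7 (2.71a), §2.8 (2.77), (2.82)–(2.83)]
-/

noncomputable section

namespace Summit.HubbardSuperconductivity.HubbardSuperconductivity.Theorems.TorusFourierL2

set_option linter.dupNamespace false -- summit = problem name (single-conjunct summit), D-0017

open Set Finset Literature.MathematicalPhysics.QuantumLattice Literature.MathematicalPhysics.QuantumLattice.BandSectorCounting
open Literature.MathematicalPhysics.QuantumLattice.FermiRG Literature.Probability.LatticeModels Literature.Analysis.SpecialFunctions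
open Summit.HubbardSuperconductivity.HubbardSuperconductivity.Theorems.DispersionFlow
open Summit.HubbardSuperconductivity.HubbardSuperconductivity.Theorems.KLRegimeSplit
open Summit.HubbardSuperconductivity.HubbardSuperconductivity.Theorems.KLProgrammeLegKernels
open Summit.HubbardSuperconductivity.HubbardSuperconductivity.Theorems.PerturbedFermiCurve
open scoped Real

open Classical

set_option maxHeartbeats 800000 in -- long binder list
/-- **The weighted neighbouring character-sum bounds on lattice `V` at the coarse flow frame `K_n`, weight scale `J′`, all levels `k + 1 ≤ m ≤ J′`, deep
window**: `≤ C_T·M·V²` (lattice-decoupled twin of `charSumWt_nbWindow_klEng_flow_deep`). [cite: BenfattoGiulianiMastropietro2006, §2.8 (2.82)–(2.83)] -/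
theorem charSumWt_nbWindow_klEng_flow_deep_vol (dd : ℕ) :
    ∃ CT : ℝ, 0 < CT ∧
      ∀ (G : GeoConsts) (P : SplitConsts) (R : RenConsts) (Q : EngConsts) (cc : ℝ), R.WF2 → 0 < cc → cc ≤ EngineV8.klEngC₃6 P R →
      ∀ μ ∈ klWindowC, ∀ U : ℝ, 0 < U → U ≤ min (EngineV8.klEngU₀3 P R cc) (1 / (R.Gfr 3 + 1)) →
      ∀ β : ℝ, klBetaMin ≤ β → β ≤ Real.exp (cc / U ^ 2) →
      ∀ (L M : ℕ) [NeZero L] [NeZero M], EngineV8.klEngL₃ β U ≤ L → EngineV8.klEngM₃ β U L ≤ M →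
      ∀ n : ℕ, 1 ≤ n → n ≤ nScales β + 1 →
        HistP klPredsV17F2 L M G P Q R β U μ 0 n → FrameOK R U (nScales β) μ (klFlowFrameU L M β U μ n) →
        ∀ (V : ℕ) [NeZero V], EngineV8.klEngL₃ β U ≤ V →
        ∀ k J' : ℕ, k + 1 ≤ J' → J' ≤ n → (4 : ℝ) ^ n * U ≤ (4 : ℝ) ^ (2 * (k + 1) + dd) →
        ∀ m : ℕ, k + 1 ≤ m → m ≤ J' → ∀ (ω : Fin (sectorCount m)) (a' : Fin (sectorCount (m - 1))),
          ∑ z : TorusSite 1 (2 * M) × TorusSite 2 V,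
            (1 + klScale klE0 J' * β / (2 * M) * |(((z.1 0).valMinAbs : ℤ) : ℝ)| + klScale klE0 J' * |(((z.2 0).valMinAbs : ℤ) : ℝ)| +
                klScale klE0 J' * |(((z.2 1).valMinAbs : ℤ) : ℝ)|) *
            ‖∑ q : TorusSite 1 (2 * M) × TorusSite 2 V, (torusChar q.1 z.1 * torusChar q.2 z.2) •
              (klAnisoFamily V M β μ (klFlowFrameU L M β U μ n) klE0 m ω (⟨(q.1 0).val, ZMod.val_lt (q.1 0)⟩, q.2) *
                klAnisoFamily V M β μ (klFlowFrameU L M β U μ n) klE0 (m - 1) a' (⟨(q.1 0).val, ZMod.val_lt (q.1 0)⟩, q.2))‖ ≤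
            CT * M * (V : ℝ) ^ 2 := by
  have ha : (-4 : ℝ) < -(6 / 5) := by norm_num
  have hab : (-(6 / 5) : ℝ) ≤ -(1 / 10) := by norm_num
  have hb : (-(1 / 10) : ℝ) < 0 := by norm_num
  obtain ⟨CT, hCT, h⟩ := charSumWt_klAnisoPair_nb_of_thresholds ha hab hb ((4 : ℝ) ^ dd / 3072)
  refine ⟨CT, hCT, ?_⟩
  intro G P R Q cc hR2 hcc hcc6 μ hμ U hU hUle β hβmin hβc L M _ _ hL3 hM3 n hn1 hnN hhist hfr V _ hV3 k J' hJ hJn hnd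
  have hRj : ∀ j, 0 ≤ R.Gfr j := EngineV8.gfr_nonneg_of_wf2 hR2
  have hβ0 : 0 < β := pos_of_klBetaMin_le hβmin
  have hM0 : (0 : ℝ) < M := Nat.cast_pos.2 (Nat.pos_of_ne_zero (NeZero.ne M))
  have hcle := (hcc6.trans (EngineV8.klEngC₃6_le_klEngC₃3 P R)).trans (EngineV8.klEngC₃3_le_symbolC₃ ha hab hb P hRj)
  have hU3 := (hUle.trans (min_le_left _ _)).trans (EngineV8.klEngU₀3_le_symbolU₀ ha hab hb P hRj cc)
  have hUG : U ≤ 1 / (R.Gfr 3 + 1) := hUle.trans (min_le_right _ _)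
  have hVβ : β ^ 2 ≤ (V : ℝ) := EngineV8.sq_le_of_klEngL₃_le hV3
  have hMβ : β ≤ (M : ℝ) := EngineV8.le_of_klEngM₃_le hβmin hL3 hM3
  set K : TrigPolyC4v := klFlowFrameU L M β U μ n with hKdef
  obtain ⟨N, rfl⟩ : ∃ N, n = N + 1 := ⟨n - 1, by omega⟩
  have hh := (histP_klPredsV17F2_iff L M G P Q R β U μ 0 (N + 1)).1 hhist
  have hJets : ∀ m ≤ N, FlowPieceJetsAt L M β U μ R m := fun m hm => (hh m (Nat.lt_succ_of_le hm)).2.1.2.1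
  have hGeo : FlowGeometryAt L M β U μ N := (hh N (Nat.lt_succ_self N)).2.1.2.2
  have hK1 : FrameOK R U N μ K := frameOK_klFlowFrameU_succ hJets hGeo
  have hA3 : ∀ p : Momentum, ‖iteratedFDeriv ℝ 3 (frameShift K) p‖ ≤ R.Gfr 3 * U ^ 2 * ((4 : ℝ) ^ (N + 1) / 3) :=
    (frameShift_high_sizes_of_frameOK hRj hK1).1
  have hGU : R.Gfr 3 * U ≤ 1 := by
    have hG3 := hRj 3
    calc R.Gfr 3 * U ≤ R.Gfr 3 * (1 / (R.Gfr 3 + 1)) := mul_le_mul_of_nonneg_left hUG hG3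
      _ = R.Gfr 3 / (R.Gfr 3 + 1) := by ring
      _ ≤ 1 := by rw [div_le_one (by positivity)]; linarith only [hG3]
  have hdat : ∀ m : ℕ, k + 1 ≤ m → R.Gfr 3 * U ^ 2 * ((4 : ℝ) ^ (N + 1) / 3) * klScale klE0 m ^ 2 ≤ (4 : ℝ) ^ dd / 3072 :=
    fun m hm => frameDatumAt_le_of_pow_window hU.le hGU hm hnd
  intro m hkm hmJ ω a'
  have hbd := h R hRj cc U hcc hcle hU hU3 β hβmin hβc μ hμ K hfr (R.Gfr 3 * U ^ 2 * ((4 : ℝ) ^ (N + 1) / 3)) hA3 V M hVβ hMβ m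
    (by omega) (by omega) (hdat m hkm) ω a'
  refine le_trans (sum_le_sum fun z _ => mul_le_mul_of_nonneg_right ?_ (norm_nonneg _)) hbd
  have hΛle : klScale klE0 J' ≤ klScale klE0 m := EngineV8.klScale_le_klScale (by norm_num [klE0]) hmJ
  have h0 : 0 ≤ |(((z.1 0).valMinAbs : ℤ) : ℝ)| := abs_nonneg _
  have h1 : 0 ≤ |(((z.2 0).valMinAbs : ℤ) : ℝ)| := abs_nonneg _
  have h2 : 0 ≤ |(((z.2 1).valMinAbs : ℤ) : ℝ)| := abs_nonneg _
  have hβM : 0 ≤ β / (2 * M) := by positivity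
  have hΛ0 : 0 ≤ klScale klE0 J' := (klth_klScale_pos J').le
  have ht : klScale klE0 J' * β / (2 * M) ≤ klScale klE0 m * β / (2 * M) := by
    rw [mul_div_assoc, mul_div_assoc]; exact mul_le_mul_of_nonneg_right hΛle hβM
  gcongr

set_option maxHeartbeats 800000 in -- long binder list
/-- **The weighted overlap / re-sectorisation constants of `E_V(klAnisoFamily J′)·S_V(F̃_k)` on lattice `V` at the coarse flow frame `K_n`, deep window**:
weighted row sums `≤ 81·C_J·M/β`, weighted per-pair position sums (both orientations) `≤ 3·C_J·M/β` (lattice-decoupled twin of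
`overlapWt_jump_sums_klEng_flow_deep`). [cite: BenfattoGiulianiMastropietro2006, §2.7 (2.71a), §2.8 (2.77), (2.82)–(2.83)] -/
theorem overlapWt_jump_sums_klEng_flow_deep_vol (dd : ℕ) :
    ∃ CJ : ℝ, 0 < CJ ∧
      ∀ (G : GeoConsts) (P : SplitConsts) (R : RenConsts) (Q : EngConsts) (cc : ℝ), R.WF2 → 0 < cc → cc ≤ EngineV8.klEngC₃6 P R →
      ∀ μ ∈ klWindowC, ∀ U : ℝ, 0 < U → U ≤ min (EngineV8.klEngU₀3 P R cc) (1 / (R.Gfr 3 + 1)) →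
      ∀ β : ℝ, klBetaMin ≤ β → β ≤ Real.exp (cc / U ^ 2) →
      ∀ (L M : ℕ) [NeZero L] [NeZero M], EngineV8.klEngL₃ β U ≤ L → EngineV8.klEngM₃ β U L ≤ M →
      ∀ n : ℕ, 1 ≤ n → n ≤ nScales β + 1 →
        HistP klPredsV17F2 L M G P Q R β U μ 0 n → FrameOK R U (nScales β) μ (klFlowFrameU L M β U μ n) →
        ∀ (V : ℕ) [NeZero V], EngineV8.klEngL₃ β U ≤ V →
        ∀ k J' : ℕ, k + 1 ≤ J' → J' ≤ n → (4 : ℝ) ^ n * U ≤ (4 : ℝ) ^ (2 * (k + 1) + dd) →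
        (∀ X'' : SpaceTimeIdx V M × SectorLeg (sectorCount J'),
          ∑ X', ‖(sectorAnalysisMatrix V M β (klAnisoFamily V M β μ (klFlowFrameU L M β U μ n) klE0 J') *
            sectorSubMatrix V M β (bgmFatMultiplier V M klE0 β (nambuXiCT V μ (klFlowFrameU L M β U μ n)) k)) X'' X'‖ *
              EngineV8.klScaleWt V M β J' {EngineV8.latticeLegPos (2 * (2 * M)) X'', EngineV8.latticeLegPos (2 * (2 * M)) X'} ≤
            81 * CJ * M / β) ∧
        (∀ (ω'' : Fin (sectorCount J')) (ω' : Fin (sectorCount k)) (σ c : Fin 2) (x' : SpaceTimeIdx V M),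
          ∑ x'' : SpaceTimeIdx V M, ‖(sectorAnalysisMatrix V M β (klAnisoFamily V M β μ (klFlowFrameU L M β U μ n) klE0 J') *
            sectorSubMatrix V M β (bgmFatMultiplier V M klE0 β (nambuXiCT V μ (klFlowFrameU L M β U μ n)) k))
              (x'', ((ω'', σ), c)) (x', ((ω', σ), c))‖ *
              EngineV8.klScaleWt V M β J'
                {EngineV8.latticeLegPos (2 * (2 * M)) ((x'', ((ω'', σ), c)) : SpaceTimeIdx V M × SectorLeg (sectorCount J')),
                  EngineV8.latticeLegPos (2 * (2 * M)) ((x', ((ω', σ), c)) : SpaceTimeIdx V M × SectorLeg (sectorCount k))} ≤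
            3 * CJ * M / β) ∧
        (∀ (ω'' : Fin (sectorCount J')) (ω' : Fin (sectorCount k)) (σ c : Fin 2) (x'' : SpaceTimeIdx V M),
          ∑ x' : SpaceTimeIdx V M, ‖(sectorAnalysisMatrix V M β (klAnisoFamily V M β μ (klFlowFrameU L M β U μ n) klE0 J') *
            sectorSubMatrix V M β (bgmFatMultiplier V M klE0 β (nambuXiCT V μ (klFlowFrameU L M β U μ n)) k))
              (x'', ((ω'', σ), c)) (x', ((ω', σ), c))‖ *
              EngineV8.klScaleWt V M β J'
                {EngineV8.latticeLegPos (2 * (2 * M)) ((x'', ((ω'', σ), c)) : SpaceTimeIdx V M × SectorLeg (sectorCount J')),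
                  EngineV8.latticeLegPos (2 * (2 * M)) ((x', ((ω', σ), c)) : SpaceTimeIdx V M × SectorLeg (sectorCount k))} ≤
            3 * CJ * M / β) := by
  obtain ⟨CT, hCT, h⟩ := charSumWt_nbWindow_klEng_flow_deep_vol dd
  refine ⟨CT + 729 * CT ^ 2 / 2, by positivity, ?_⟩
  intro G P R Q cc hR2 hcc hcc6 μ hμ U hU hUle β hβmin hβc L M _ _ hL3 hM3 n hn1 hnN hhist hfr V _ hV3 k J' hJ hJn hnd
  have hβ0 : 0 < β := pos_of_klBetaMin_le hβmin
  have hV0 : (0 : ℝ) < V := Nat.cast_pos.2 (Nat.pos_of_ne_zero (NeZero.ne V))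
  have hM0 : (0 : ℝ) < M := Nat.cast_pos.2 (Nat.pos_of_ne_zero (NeZero.ne M))
  have hT := h G P R Q cc hR2 hcc hcc6 μ hμ U hU hUle β hβmin hβc L M hL3 hM3 n hn1 hnN hhist hfr V hV3 k J' hJ hJn hnd
  have hT0 : 0 ≤ CT * M * (V : ℝ) ^ 2 := by positivity
  obtain ⟨hrow, hcol₁, hrow₁⟩ := overlapWt_jump_sums_le_of_nbWindow (L := V) (M := M) hβ0 μ (klFlowFrameU L M β U μ n) (n₀ := k + 1) hT0 hT
    le_rfl hJ
  have eTJ : CT * M * (V : ℝ) ^ 2 + 729 * ((((2 * M : ℕ) : ℝ) ^ 1 * (V : ℝ) ^ 2)⁻¹ * (CT * M * (V : ℝ) ^ 2) ^ 2) =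
      (CT + 729 * CT ^ 2 / 2) * M * (V : ℝ) ^ 2 := by
    push_cast
    field_simp
  have e81 : ((27 : ℕ) : ℝ) * (3 * ((CT + 729 * CT ^ 2 / 2) * M * (V : ℝ) ^ 2) / (β * (V : ℝ) ^ 2)) =
      81 * (CT + 729 * CT ^ 2 / 2) * M / β := by
    push_cast
    field_simp
    ring
  have e3 : 3 * ((CT + 729 * CT ^ 2 / 2) * M * (V : ℝ) ^ 2) / (β * (V : ℝ) ^ 2) = 3 * (CT + 729 * CT ^ 2 / 2) * M / β := by
    field_simp
  refine ⟨fun X'' => ?_, fun ω'' ω' σ c x' => ?_, fun ω'' ω' σ c x'' => ?_⟩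
  · have h1 := hrow X''
    rw [eTJ, e81] at h1
    exact h1
  · have h1 := hcol₁ ω'' ω' σ c x'
    rw [eTJ, e3] at h1
    exact h1
  · have h1 := hrow₁ ω'' ω' σ c x''
    rw [eTJ, e3] at h1
    exact h1

set_option maxHeartbeats 800000 in -- long binder list
/-- **The full weighted COLUMN sums of `E_V(klAnisoFamily J′)·S_V(F̃_k)` on lattice `V` at the coarse flow frame `K_n`, deep window**:
`≤ 81·2^{J′−k}·C_J·M/β` (lattice-decoupled twin of `overlapWt_colSum_klEng_flow_deep`). [cite: BenfattoGiulianiMastropietro2006, §2.7 (2.71a), §2.8 (2.77)] -/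
theorem overlapWt_colSum_klEng_flow_deep_vol (dd : ℕ) :
    ∃ CJ : ℝ, 0 < CJ ∧
      ∀ (G : GeoConsts) (P : SplitConsts) (R : RenConsts) (Q : EngConsts) (cc : ℝ), R.WF2 → 0 < cc → cc ≤ EngineV8.klEngC₃6 P R →
      ∀ μ ∈ klWindowC, ∀ U : ℝ, 0 < U → U ≤ min (EngineV8.klEngU₀3 P R cc) (1 / (R.Gfr 3 + 1)) →
      ∀ β : ℝ, klBetaMin ≤ β → β ≤ Real.exp (cc / U ^ 2) →
      ∀ (L M : ℕ) [NeZero L] [NeZero M], EngineV8.klEngL₃ β U ≤ L → EngineV8.klEngM₃ β U L ≤ M →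
      ∀ n : ℕ, 1 ≤ n → n ≤ nScales β + 1 →
        HistP klPredsV17F2 L M G P Q R β U μ 0 n → FrameOK R U (nScales β) μ (klFlowFrameU L M β U μ n) →
        ∀ (V : ℕ) [NeZero V], EngineV8.klEngL₃ β U ≤ V →
        ∀ k J' : ℕ, k + 1 ≤ J' → J' ≤ n → (4 : ℝ) ^ n * U ≤ (4 : ℝ) ^ (2 * (k + 1) + dd) →
        ∀ X' : SpaceTimeIdx V M × SectorLeg (sectorCount k),
          ∑ X'' : SpaceTimeIdx V M × SectorLeg (sectorCount J'),
            ‖(sectorAnalysisMatrix V M β (klAnisoFamily V M β μ (klFlowFrameU L M β U μ n) klE0 J') *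
              sectorSubMatrix V M β (bgmFatMultiplier V M klE0 β (nambuXiCT V μ (klFlowFrameU L M β U μ n)) k)) X'' X'‖ *
              EngineV8.klScaleWt V M β J' {EngineV8.latticeLegPos (2 * (2 * M)) X'', EngineV8.latticeLegPos (2 * (2 * M)) X'} ≤
            81 * (2 : ℝ) ^ (J' - k) * CJ * M / β := by
  obtain ⟨CT, hCT, h⟩ := charSumWt_nbWindow_klEng_flow_deep_vol dd
  refine ⟨CT + 729 * CT ^ 2 / 2, by positivity, ?_⟩
  intro G P R Q cc hR2 hcc hcc6 μ hμ U hU hUle β hβmin hβc L M _ _ hL3 hM3 n hn1 hnN hhist hfr V _ hV3 k J' hJ hJn hnd X'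
  have hβ0 : 0 < β := pos_of_klBetaMin_le hβmin
  have hV0 : (0 : ℝ) < V := Nat.cast_pos.2 (Nat.pos_of_ne_zero (NeZero.ne V))
  have hM0 : (0 : ℝ) < M := Nat.cast_pos.2 (Nat.pos_of_ne_zero (NeZero.ne M))
  have hT := h G P R Q cc hR2 hcc hcc6 μ hμ U hU hUle β hβmin hβc L M hL3 hM3 n hn1 hnN hhist hfr V hV3 k J' hJ hJn hnd
  have hT0 : 0 ≤ CT * M * (V : ℝ) ^ 2 := by positivity
  have hcol := overlapWt_colSum_le_of_nbWindow (L := V) (M := M) hβ0 μ (klFlowFrameU L M β U μ n) (n₀ := k + 1) hT0 hT le_rfl hJ X'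
  have eTJ : CT * M * (V : ℝ) ^ 2 + 729 * ((((2 * M : ℕ) : ℝ) ^ 1 * (V : ℝ) ^ 2)⁻¹ * (CT * M * (V : ℝ) ^ 2) ^ 2) =
      (CT + 729 * CT ^ 2 / 2) * M * (V : ℝ) ^ 2 := by
    push_cast
    field_simp
  have e81 : ((27 * 2 ^ (J' - k) : ℕ) : ℝ) * (3 * ((CT + 729 * CT ^ 2 / 2) * M * (V : ℝ) ^ 2) / (β * (V : ℝ) ^ 2)) =
      81 * (2 : ℝ) ^ (J' - k) * (CT + 729 * CT ^ 2 / 2) * M / β := by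
    push_cast
    field_simp
    ring
  rw [eTJ, e81] at hcol
  exact hcol

end Summit.HubbardSuperconductivity.HubbardSuperconductivity.Theorems.TorusFourierL2

end
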